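import Mathlib.LinearAlgebra.Matrix.Determinant.Basic
import Mathlib.LinearAlgebra.Matrix.Notation
import Mathlib.Data.Matrix.Mul
import Mathlib.RingTheory.Ideal.Basic
import Mathlib.Algebra.Regular.Basic
import Mathlib.Tactic.Ring
import Mathlib.Tactic.LinearCombination
import Mathlib.Tactic.FinCases

/-!
# [OURS · L1 W4.5(b)] child EL♮(3) `EquisingularLiftNatThree` (stmt-ResolutionOfSingularities-20148) —
# brick T-F7MINUS: the standard 7-point frame over a commutative ring (F₇⁻ normalisation)

Helper file `--supports stmt-ResolutionOfSingularities-20148` (cell `res-hironaka`, crux chain w45b; seat res-type-029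
acting as FREE NAMED RESERVE on the plan seat's terms; context: res-L1-w45b-plan-1 PLANNER-MEMO-g7-2 §N2 «F₇⁻
NORMALISATION», CHAIN w45b v7.3 §3 row T-F7MINUS). NOT a statement of any manuscript; OURS, elementary linear algebra
over Mathlib (`Matrix.det_fin_three`). AI-written, weaker than expert review. No definition is declared.

**Content.** Let `R` be any commutative ring and consider the standard frame of seven vectors in `R³`
`e₀ = (1,0,0)`, `e₁ = (0,1,0)`, `e₂ = (0,0,1)`, `e₃ = e₀ + e₁ = (1,1,0)`, `e₄ = e₀ + e₂ = (1,0,1)`, `e₅ = e₁ + e₂ = (0,1,1)`,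
`e₆ = e₀ + e₁ + e₂ = (1,1,1)` (the seven points of `ℙ²(𝔽₂)` read with integer coordinates). Of the seven Fano triples,
* the SIX triples `{e₀,e₁,e₃}`, `{e₀,e₂,e₄}`, `{e₁,e₂,e₅}`, `{e₀,e₅,e₆}`, `{e₁,e₄,e₆}`, `{e₂,e₃,e₆}` are collinear over `R`
  EXACTLY: their `3 × 3` determinants are `0` (`det_triple₁` … `det_triple₆`) and they lie on the explicit lines
  `x₂ = 0`, `x₁ = 0`, `x₀ = 0`, `x₁ = x₂`, `x₀ = x₂`, `x₀ = x₁` (`line₁_vanishes` … `line₆_vanishes`: a linear form with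
  unimodular coefficient vector vanishing on the three vectors);
* the SEVENTH triple `{e₃,e₄,e₅}` has determinant `-2` (`det_triple₇`); the form `x₀ + x₁ + x₂` takes the value `2` on each
  of `e₃, e₄, e₅` (`sumForm_triple₇`), so the triple IS collinear modulo every ideal containing `2`
  (`det_triple₇_mem_of_two_mem`, `sumForm_triple₇_mem_of_two_mem` — Fano reduction in residue characteristic `2`), while
  if `2` is a non-zero-divisor of `R` (any domain with `2 ≠ 0`, e.g. a characteristic-`0` DVR) the determinant is non-zero
  (`det_triple₇_ne_zero`, domain form `det_triple₇_ne_zero_of_isDomain`) and NO non-zero linear form vanishes on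
  `e₃, e₄, e₅` (`linearForm_eq_zero_of_vanishes_triple₇`, domain form `…_of_isDomain`: there is no line through the
  three points over `R`).
* the other `28` triples of frame vectors are UNIMODULAR (determinant `±1` over any commutative ring,
  `det_offLine_triples`): the frame has no accidental collinearity, i.e. it realises the non-Fano matroid `F₇⁻` over
  every domain with `2 ≠ 0` (dependent triples = the six exact lines), and the Fano matroid `F₇` over every field of
  characteristic `2` (dependent triples = all seven lines).
The packaged form `frame_dets` states all seven determinant values for an arbitrary family `e : Fin 7 → (Fin 3 → R)`
satisfying the seven defining equations. Reading (PLANNER-MEMO-g7-2 §N2): with the seven in-carrier sections chosen as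
this frame over a DVR `O` of residue characteristic `2`, six Fano lines lift exactly over `O` and exactly one (`ℓ₇`)
does not; that NO choice of sections does better (the Fano plane `F₇` is not representable when `2 ≠ 0`) is the tree
lemma `Summit.ResolutionOfSingularities.ResolutionOfSingularities.Theorems.EquisingularLift.Negative.fano_configuration_no_lift`
(file `Theorems/EquisingularLift/Negative/FanoConfigurationNoLift.lean`), cited by name and not restated here.
Kernel-only (propext, Classical.choice, Quot.sound). [folklore]
-/

set_option linter.dupNamespace false

namespace Summit.ResolutionOfSingularities.ResolutionOfSingularities.Theorems.EquisingularLiftNat.FanoMinusFrame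

open Matrix

variable {R : Type*} [CommRing R]

/-! ## The six exact Fano triples (determinant `0` over any commutative ring) -/

/-- Triple `{e₀, e₁, e₃} = {(1,0,0), (0,1,0), (1,1,0)}`: determinant `0`. [folklore] -/
theorem det_triple₁ : (!![1, 0, 0; 0, 1, 0; 1, 1, 0] : Matrix (Fin 3) (Fin 3) R).det = 0 := by
  simp [Matrix.det_fin_three]

/-- Triple `{e₀, e₂, e₄} = {(1,0,0), (0,0,1), (1,0,1)}`: determinant `0`. [folklore] -/
theorem det_triple₂ : (!![1, 0, 0; 0, 0, 1; 1, 0, 1] : Matrix (Fin 3) (Fin 3) R).det = 0 := by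
  simp [Matrix.det_fin_three]

/-- Triple `{e₁, e₂, e₅} = {(0,1,0), (0,0,1), (0,1,1)}`: determinant `0`. [folklore] -/
theorem det_triple₃ : (!![0, 1, 0; 0, 0, 1; 0, 1, 1] : Matrix (Fin 3) (Fin 3) R).det = 0 := by
  simp [Matrix.det_fin_three]

/-- Triple `{e₀, e₅, e₆} = {(1,0,0), (0,1,1), (1,1,1)}`: determinant `0`. [folklore] -/
theorem det_triple₄ : (!![1, 0, 0; 0, 1, 1; 1, 1, 1] : Matrix (Fin 3) (Fin 3) R).det = 0 := by
  simp [Matrix.det_fin_three]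

/-- Triple `{e₁, e₄, e₆} = {(0,1,0), (1,0,1), (1,1,1)}`: determinant `0`. [folklore] -/
theorem det_triple₅ : (!![0, 1, 0; 1, 0, 1; 1, 1, 1] : Matrix (Fin 3) (Fin 3) R).det = 0 := by
  simp [Matrix.det_fin_three]

/-- Triple `{e₂, e₃, e₆} = {(0,0,1), (1,1,0), (1,1,1)}`: determinant `0`. [folklore] -/
theorem det_triple₆ : (!![0, 0, 1; 1, 1, 0; 1, 1, 1] : Matrix (Fin 3) (Fin 3) R).det = 0 := by
  simp [Matrix.det_fin_three]

/-! ## The six exact triples lie on explicit lines (unimodular linear forms vanishing on the three vectors) -/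

/-- `{e₀, e₁, e₃}` lies on the line `x₂ = 0`: the form with coefficient vector `(0,0,1)` vanishes on the three vectors.
[folklore] -/
theorem line₁_vanishes :
    ![(0 : R), 0, 1] ⬝ᵥ ![1, 0, 0] = 0 ∧ ![(0 : R), 0, 1] ⬝ᵥ ![0, 1, 0] = 0 ∧ ![(0 : R), 0, 1] ⬝ᵥ ![1, 1, 0] = 0 := by
  simp [dotProduct, Fin.sum_univ_three]

/-- `{e₀, e₂, e₄}` lies on the line `x₁ = 0` (coefficient vector `(0,1,0)`). [folklore] -/
theorem line₂_vanishes :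
    ![(0 : R), 1, 0] ⬝ᵥ ![1, 0, 0] = 0 ∧ ![(0 : R), 1, 0] ⬝ᵥ ![0, 0, 1] = 0 ∧ ![(0 : R), 1, 0] ⬝ᵥ ![1, 0, 1] = 0 := by
  simp [dotProduct, Fin.sum_univ_three]

/-- `{e₁, e₂, e₅}` lies on the line `x₀ = 0` (coefficient vector `(1,0,0)`). [folklore] -/
theorem line₃_vanishes :
    ![(1 : R), 0, 0] ⬝ᵥ ![0, 1, 0] = 0 ∧ ![(1 : R), 0, 0] ⬝ᵥ ![0, 0, 1] = 0 ∧ ![(1 : R), 0, 0] ⬝ᵥ ![0, 1, 1] = 0 := by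
  simp [dotProduct, Fin.sum_univ_three]

/-- `{e₀, e₅, e₆}` lies on the line `x₁ = x₂` (coefficient vector `(0,1,-1)`). [folklore] -/
theorem line₄_vanishes :
    ![(0 : R), 1, -1] ⬝ᵥ ![1, 0, 0] = 0 ∧ ![(0 : R), 1, -1] ⬝ᵥ ![0, 1, 1] = 0 ∧
      ![(0 : R), 1, -1] ⬝ᵥ ![1, 1, 1] = 0 := by
  simp [dotProduct, Fin.sum_univ_three]

/-- `{e₁, e₄, e₆}` lies on the line `x₀ = x₂` (coefficient vector `(1,0,-1)`). [folklore] -/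
theorem line₅_vanishes :
    ![(1 : R), 0, -1] ⬝ᵥ ![0, 1, 0] = 0 ∧ ![(1 : R), 0, -1] ⬝ᵥ ![1, 0, 1] = 0 ∧
      ![(1 : R), 0, -1] ⬝ᵥ ![1, 1, 1] = 0 := by
  simp [dotProduct, Fin.sum_univ_three]

/-- `{e₂, e₃, e₆}` lies on the line `x₀ = x₁` (coefficient vector `(1,-1,0)`). [folklore] -/
theorem line₆_vanishes :
    ![(1 : R), -1, 0] ⬝ᵥ ![0, 0, 1] = 0 ∧ ![(1 : R), -1, 0] ⬝ᵥ ![1, 1, 0] = 0 ∧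
      ![(1 : R), -1, 0] ⬝ᵥ ![1, 1, 1] = 0 := by
  simp [dotProduct, Fin.sum_univ_three]

/-! ## The seventh triple `{e₃, e₄, e₅}`: determinant `-2` -/

/-- Triple `{e₃, e₄, e₅} = {(1,1,0), (1,0,1), (0,1,1)}`: determinant `-2` over any commutative ring. [folklore] -/
theorem det_triple₇ : (!![1, 1, 0; 1, 0, 1; 0, 1, 1] : Matrix (Fin 3) (Fin 3) R).det = -2 := by
  simp [Matrix.det_fin_three]; norm_num

/-- The form `x₀ + x₁ + x₂` (coefficient vector `(1,1,1)`) takes the value `2` on each of `e₃, e₄, e₅`. [folklore] -/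
theorem sumForm_triple₇ :
    ![(1 : R), 1, 1] ⬝ᵥ ![1, 1, 0] = 2 ∧ ![(1 : R), 1, 1] ⬝ᵥ ![1, 0, 1] = 2 ∧ ![(1 : R), 1, 1] ⬝ᵥ ![0, 1, 1] = 2 := by
  simp [dotProduct, Fin.sum_univ_three]; norm_num

/-- **Fano reduction.** Modulo any ideal `I ∋ 2` the seventh determinant vanishes: `det {e₃,e₄,e₅} ∈ I`. [folklore] -/
theorem det_triple₇_mem_of_two_mem (I : Ideal R) (h2 : (2 : R) ∈ I) :
    (!![1, 1, 0; 1, 0, 1; 0, 1, 1] : Matrix (Fin 3) (Fin 3) R).det ∈ I := by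
  rw [det_triple₇]
  exact I.neg_mem_iff.mpr h2

/-- **Fano reduction, line form.** Modulo any ideal `I ∋ 2` the unimodular form `x₀ + x₁ + x₂` vanishes on
`e₃, e₄, e₅`: its three values lie in `I` (so the seven points reduce to a Fano plane in `R ⧸ I` when `2 ∈ I`).
[folklore] -/
theorem sumForm_triple₇_mem_of_two_mem (I : Ideal R) (h2 : (2 : R) ∈ I) :
    ![(1 : R), 1, 1] ⬝ᵥ ![1, 1, 0] ∈ I ∧ ![(1 : R), 1, 1] ⬝ᵥ ![1, 0, 1] ∈ I ∧ ![(1 : R), 1, 1] ⬝ᵥ ![0, 1, 1] ∈ I := by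
  obtain ⟨h₁, h₂, h₃⟩ := (sumForm_triple₇ (R := R))
  rw [h₁, h₂, h₃]
  exact ⟨h2, h2, h2⟩

/-- **No lift of the seventh line when `2` is a non-zero-divisor.** If `2` is left-regular in `R` (e.g. `R` a domain
with `2 ≠ 0`, a DVR of characteristic `0`), the determinant of `{e₃, e₄, e₅}` is non-zero. [folklore] -/
theorem det_triple₇_ne_zero (h2 : IsLeftRegular (2 : R)) [Nontrivial R] :
    (!![1, 1, 0; 1, 0, 1; 0, 1, 1] : Matrix (Fin 3) (Fin 3) R).det ≠ 0 := by
  rw [det_triple₇]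
  intro h
  have h' : (2 : R) * 1 = (2 : R) * 0 := by
    have : (2 : R) = 0 := by simpa using h
    simp [this]
  exact one_ne_zero (h2 h')

/-- **No line through the three sections of `ℓ₇` when `2` is a non-zero-divisor.** If `2` is left-regular in `R`,
every linear form `ℓ = a x₀ + b x₁ + c x₂` vanishing on `e₃ = (1,1,0)`, `e₄ = (1,0,1)`, `e₅ = (0,1,1)` is zero:
`a + b = a + c = b + c = 0` forces `2a = 2b = 2c = 0`, hence `a = b = c = 0`. [folklore] -/
theorem linearForm_eq_zero_of_vanishes_triple₇ (h2 : IsLeftRegular (2 : R)) (ℓ : Fin 3 → R)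
    (h₃ : ℓ ⬝ᵥ ![1, 1, 0] = 0) (h₄ : ℓ ⬝ᵥ ![1, 0, 1] = 0) (h₅ : ℓ ⬝ᵥ ![0, 1, 1] = 0) : ℓ = 0 := by
  simp only [dotProduct, Fin.sum_univ_three, Matrix.cons_val_zero, Matrix.cons_val_one, Matrix.head_cons,
    Matrix.cons_val_two, Matrix.tail_cons, mul_one, mul_zero, add_zero, zero_add] at h₃ h₄ h₅
  have ha : (2 : R) * ℓ 0 = (2 : R) * 0 := by linear_combination h₃ + h₄ - h₅
  have hb : (2 : R) * ℓ 1 = (2 : R) * 0 := by linear_combination h₃ - h₄ + h₅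
  have hc : (2 : R) * ℓ 2 = (2 : R) * 0 := by linear_combination -h₃ + h₄ + h₅
  have ha' := h2 ha
  have hb' := h2 hb
  have hc' := h2 hc
  funext i
  fin_cases i <;> simp [ha', hb', hc']

/-- Domain form of `det_triple₇_ne_zero`: in a domain with `2 ≠ 0` (e.g. a DVR of characteristic `0`) the
determinant of `{e₃, e₄, e₅}` is non-zero. [folklore] -/
theorem det_triple₇_ne_zero_of_isDomain [IsDomain R] (h2 : (2 : R) ≠ 0) :
    (!![1, 1, 0; 1, 0, 1; 0, 1, 1] : Matrix (Fin 3) (Fin 3) R).det ≠ 0 :=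
  det_triple₇_ne_zero (IsRegular.of_ne_zero h2).left

/-- Domain form of `linearForm_eq_zero_of_vanishes_triple₇`: in a domain with `2 ≠ 0` no non-zero linear form vanishes
on `e₃, e₄, e₅` — there is no line through the three sections of `ℓ₇`. [folklore] -/
theorem linearForm_eq_zero_of_vanishes_triple₇_of_isDomain [IsDomain R] (h2 : (2 : R) ≠ 0) (ℓ : Fin 3 → R)
    (h₃ : ℓ ⬝ᵥ ![1, 1, 0] = 0) (h₄ : ℓ ⬝ᵥ ![1, 0, 1] = 0) (h₅ : ℓ ⬝ᵥ ![0, 1, 1] = 0) : ℓ = 0 :=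
  linearForm_eq_zero_of_vanishes_triple₇ (IsRegular.of_ne_zero h2).left ℓ h₃ h₄ h₅

/-! ## The other 28 triples are unimodular (no accidental collinearity) -/

/-- **The frame realises the non-Fano matroid `F₇⁻` exactly.** Each of the `28` triples of frame vectors that is NOT
one of the seven Fano triples has determinant `1` or `-1` over any commutative ring (listed in lexicographic order of
the index triple, superscript `⁺`/`⁻` = sign: {e₀,e₁,e₂}⁺, {e₀,e₁,e₄}⁺, {e₀,e₁,e₅}⁺, {e₀,e₁,e₆}⁺, {e₀,e₂,e₃}⁻,
{e₀,e₂,e₅}⁻, {e₀,e₂,e₆}⁻, {e₀,e₃,e₄}⁺, {e₀,e₃,e₅}⁺, {e₀,e₃,e₆}⁺, {e₀,e₄,e₅}⁻, {e₀,e₄,e₆}⁻, {e₁,e₂,e₃}⁺, {e₁,e₂,e₄}⁺,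
{e₁,e₂,e₆}⁺, {e₁,e₃,e₄}⁻, {e₁,e₃,e₅}⁻, {e₁,e₃,e₆}⁻, {e₁,e₄,e₅}⁻, {e₁,e₅,e₆}⁺, {e₂,e₃,e₄}⁻, {e₂,e₃,e₅}⁺, {e₂,e₄,e₅}⁺,
{e₂,e₄,e₆}⁺, {e₂,e₅,e₆}⁻, {e₃,e₄,e₆}⁻, {e₃,e₅,e₆}⁺, {e₄,e₅,e₆}⁻). Hence each of these `28`
triples is a basis of `R³` over any non-trivial commutative ring, and over a DOMAIN the linearly dependent triples of
the frame are exactly the six exact lines when `2 ≠ 0` (matroid `F₇⁻`) and all seven Fano lines when `2 = 0` (`F₇`).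
[folklore] -/
theorem det_offLine_triples :
    (!![1, 0, 0; 0, 1, 0; 0, 0, 1] : Matrix (Fin 3) (Fin 3) R).det = 1 ∧
    (!![1, 0, 0; 0, 1, 0; 1, 0, 1] : Matrix (Fin 3) (Fin 3) R).det = 1 ∧
    (!![1, 0, 0; 0, 1, 0; 0, 1, 1] : Matrix (Fin 3) (Fin 3) R).det = 1 ∧
    (!![1, 0, 0; 0, 1, 0; 1, 1, 1] : Matrix (Fin 3) (Fin 3) R).det = 1 ∧
    (!![1, 0, 0; 0, 0, 1; 1, 1, 0] : Matrix (Fin 3) (Fin 3) R).det = -1 ∧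
    (!![1, 0, 0; 0, 0, 1; 0, 1, 1] : Matrix (Fin 3) (Fin 3) R).det = -1 ∧
    (!![1, 0, 0; 0, 0, 1; 1, 1, 1] : Matrix (Fin 3) (Fin 3) R).det = -1 ∧
    (!![1, 0, 0; 1, 1, 0; 1, 0, 1] : Matrix (Fin 3) (Fin 3) R).det = 1 ∧
    (!![1, 0, 0; 1, 1, 0; 0, 1, 1] : Matrix (Fin 3) (Fin 3) R).det = 1 ∧
    (!![1, 0, 0; 1, 1, 0; 1, 1, 1] : Matrix (Fin 3) (Fin 3) R).det = 1 ∧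
    (!![1, 0, 0; 1, 0, 1; 0, 1, 1] : Matrix (Fin 3) (Fin 3) R).det = -1 ∧
    (!![1, 0, 0; 1, 0, 1; 1, 1, 1] : Matrix (Fin 3) (Fin 3) R).det = -1 ∧
    (!![0, 1, 0; 0, 0, 1; 1, 1, 0] : Matrix (Fin 3) (Fin 3) R).det = 1 ∧
    (!![0, 1, 0; 0, 0, 1; 1, 0, 1] : Matrix (Fin 3) (Fin 3) R).det = 1 ∧
    (!![0, 1, 0; 0, 0, 1; 1, 1, 1] : Matrix (Fin 3) (Fin 3) R).det = 1 ∧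
    (!![0, 1, 0; 1, 1, 0; 1, 0, 1] : Matrix (Fin 3) (Fin 3) R).det = -1 ∧
    (!![0, 1, 0; 1, 1, 0; 0, 1, 1] : Matrix (Fin 3) (Fin 3) R).det = -1 ∧
    (!![0, 1, 0; 1, 1, 0; 1, 1, 1] : Matrix (Fin 3) (Fin 3) R).det = -1 ∧
    (!![0, 1, 0; 1, 0, 1; 0, 1, 1] : Matrix (Fin 3) (Fin 3) R).det = -1 ∧
    (!![0, 1, 0; 0, 1, 1; 1, 1, 1] : Matrix (Fin 3) (Fin 3) R).det = 1 ∧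
    (!![0, 0, 1; 1, 1, 0; 1, 0, 1] : Matrix (Fin 3) (Fin 3) R).det = -1 ∧
    (!![0, 0, 1; 1, 1, 0; 0, 1, 1] : Matrix (Fin 3) (Fin 3) R).det = 1 ∧
    (!![0, 0, 1; 1, 0, 1; 0, 1, 1] : Matrix (Fin 3) (Fin 3) R).det = 1 ∧
    (!![0, 0, 1; 1, 0, 1; 1, 1, 1] : Matrix (Fin 3) (Fin 3) R).det = 1 ∧
    (!![0, 0, 1; 0, 1, 1; 1, 1, 1] : Matrix (Fin 3) (Fin 3) R).det = -1 ∧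
    (!![1, 1, 0; 1, 0, 1; 1, 1, 1] : Matrix (Fin 3) (Fin 3) R).det = -1 ∧
    (!![1, 1, 0; 0, 1, 1; 1, 1, 1] : Matrix (Fin 3) (Fin 3) R).det = 1 ∧
    (!![1, 0, 1; 0, 1, 1; 1, 1, 1] : Matrix (Fin 3) (Fin 3) R).det = -1 := by
  refine ⟨?_, ?_, ?_, ?_, ?_, ?_, ?_, ?_, ?_, ?_, ?_, ?_, ?_, ?_, ?_, ?_, ?_, ?_, ?_, ?_, ?_, ?_, ?_, ?_, ?_, ?_, ?_, ?_⟩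
  all_goals simp [Matrix.det_fin_three]

/-! ## Packaged form over an arbitrary family `e : Fin 7 → (Fin 3 → R)` -/

/-- **T-F7MINUS, packaged.** For any family `e : Fin 7 → R³` with `e₀ = (1,0,0)`, `e₁ = (0,1,0)`, `e₂ = (0,0,1)`,
`e₃ = (1,1,0)`, `e₄ = (1,0,1)`, `e₅ = (0,1,1)`, `e₆ = (1,1,1)` (the standard frame), the six Fano triples
`{0,1,3}`, `{0,2,4}`, `{1,2,5}`, `{0,5,6}`, `{1,4,6}`, `{2,3,6}` have determinant `0` and the seventh `{3,4,5}` has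
determinant `-2`. [folklore] -/
theorem frame_dets (e : Fin 7 → Fin 3 → R)
    (h0 : e 0 = ![1, 0, 0]) (h1 : e 1 = ![0, 1, 0]) (h2 : e 2 = ![0, 0, 1]) (h3 : e 3 = ![1, 1, 0])
    (h4 : e 4 = ![1, 0, 1]) (h5 : e 5 = ![0, 1, 1]) (h6 : e 6 = ![1, 1, 1]) :
    (Matrix.of ![e 0, e 1, e 3]).det = 0 ∧ (Matrix.of ![e 0, e 2, e 4]).det = 0 ∧
      (Matrix.of ![e 1, e 2, e 5]).det = 0 ∧ (Matrix.of ![e 0, e 5, e 6]).det = 0 ∧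
      (Matrix.of ![e 1, e 4, e 6]).det = 0 ∧ (Matrix.of ![e 2, e 3, e 6]).det = 0 ∧
      (Matrix.of ![e 3, e 4, e 5]).det = -2 := by
  simp only [h0, h1, h2, h3, h4, h5, h6]
  refine ⟨?_, ?_, ?_, ?_, ?_, ?_, ?_⟩
  all_goals simp [Matrix.det_fin_three]
  norm_num

/-- **T-F7MINUS, packaged, additive form of the hypotheses.** Same conclusion when the frame is given by the three
coordinate vectors and the relations `e₃ = e₀ + e₁`, `e₄ = e₀ + e₂`, `e₅ = e₁ + e₂`, `e₆ = e₀ + e₁ + e₂`. [folklore] -/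
theorem frame_dets' (e : Fin 7 → Fin 3 → R)
    (h0 : e 0 = ![1, 0, 0]) (h1 : e 1 = ![0, 1, 0]) (h2 : e 2 = ![0, 0, 1]) (h3 : e 3 = e 0 + e 1)
    (h4 : e 4 = e 0 + e 2) (h5 : e 5 = e 1 + e 2) (h6 : e 6 = e 0 + e 1 + e 2) :
    (Matrix.of ![e 0, e 1, e 3]).det = 0 ∧ (Matrix.of ![e 0, e 2, e 4]).det = 0 ∧
      (Matrix.of ![e 1, e 2, e 5]).det = 0 ∧ (Matrix.of ![e 0, e 5, e 6]).det = 0 ∧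
      (Matrix.of ![e 1, e 4, e 6]).det = 0 ∧ (Matrix.of ![e 2, e 3, e 6]).det = 0 ∧
      (Matrix.of ![e 3, e 4, e 5]).det = -2 := by
  have h3' : e 3 = ![1, 1, 0] := by rw [h3, h0, h1]; ext i; fin_cases i <;> simp
  have h4' : e 4 = ![1, 0, 1] := by rw [h4, h0, h2]; ext i; fin_cases i <;> simp
  have h5' : e 5 = ![0, 1, 1] := by rw [h5, h1, h2]; ext i; fin_cases i <;> simp
  have h6' : e 6 = ![1, 1, 1] := by rw [h6, h0, h1, h2]; ext i; fin_cases i <;> simp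
  exact frame_dets e h0 h1 h2 h3' h4' h5' h6'

end Summit.ResolutionOfSingularities.ResolutionOfSingularities.Theorems.EquisingularLiftNat.FanoMinusFrame
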